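import Literature.Probability.Percolation.SlabRSWGluingCoreB
import Literature.Probability.Percolation.SlabRSWGluingRoute
import HarnessLib

/-!
# Newman–Tassion–Wu 2017, §3.2 — the gluing lemmas for slabs: from a route to a surgery ending in `B̄`

Topic: `Literature/Probability/Percolation`. Companion of `SlabRSWGluingRoute.lean` for the
variant `GlueData.SurgeryB` (`SlabRSWGluingCoreB.lean`) of the local surgery of NTW's main gluing
lemma (Thm. 3.7) whose trunk ENDS at a vertex `β` of the target set `B̄` inside the cleared set
(used when the contact happens next to a target SEGMENT `B`):

* `exists_decompB` — the decomposition `Γ = p₀ ++ E₁ :: rest` at the first vertex of `Γ` over the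
  cleared set (`p₀ ≠ []` off `D̄` as soon as `D` avoids `A`; `rest ≠ []` as soon as some vertex of
  `Γ` other than its last lies over `D`).
* `exists_surgeryB_of_route` — the data `SurgeryB` from: the cleared set `D ⊆ R ∖ A`, a chosen
  end `β` over `D ∩ S ∩ B`, port data, and a route (`RouteSpec`, the tree's form of DST's three
  disjoint paths) from the first vertex `E₁` to `β` whose interior stays over `S ∖ B`.

## Sources

* C. M. Newman, V. Tassion, W. Wu, *Critical percolation and the minimal spanning tree in slabs*,
  Comm. Pure Appl. Math. 70 (2017), arXiv:1512.09107: §3.2, proof of Theorem 3.7, steps (1)–(3)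
  [NewmanTassionWu2017].
-/

noncomputable section

namespace Literature.Probability.Percolation

open MeasureTheory LatticeModels SimpleGraph Filter Topology

namespace NTW17

variable {k : ℕ} {Q : GlueData} {ω : BondConfig (slab 3 k)}

/-- **The decomposition of `Γ` at its first vertex over the cleared set.** If `D` avoids `A` and
some vertex of `Γ` other than its last lies over `D`, then `Γ = p₀ ++ E₁ :: rest` with `p₀ ≠ []`
off `D̄`, `E₁` over `D`, `rest ≠ []`. [cite: NewmanTassionWu2017, §3.2 (proof of Theorem 3.7, step (1), u′)] -/
theorem exists_decompB (hA : ω ∈ Q.evAB k) {D : Set (ℤ × ℤ)} (hDA : ∀ z ∈ D, z ∉ Q.A)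
    (hin : ∃ x ∈ Q.γ k ω, planar k x ∈ D ∧ x ≠ (Q.γ k ω).getLast (Q.γ_spec hA).1.ne_nil) :
    ∃ (p₀ : List (slab 3 k)) (E₁ : slab 3 k) (rest : List (slab 3 k)),
      Q.γ k ω = p₀ ++ E₁ :: rest ∧ p₀ ≠ [] ∧ rest ≠ [] ∧ (∀ x ∈ p₀, planar k x ∉ D) ∧
        planar k E₁ ∈ D := by
  obtain ⟨hγO, -⟩ := Q.γ_spec hA
  obtain ⟨x, hxγ, hxD, hxl⟩ := hin
  obtain ⟨p₀, E₁, rest, hγ1, hE₁D, hp₀D⟩ :=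
    exists_first_split (p := fun v => planar k v ∈ D) (Q.γ k ω) ⟨x, hxγ, hxD⟩
  have hp₀ : p₀ ≠ [] := by
    rintro rfl
    have h := hγO.head_mem hγO.ne_nil
    simp only [hγ1, List.nil_append, List.head_cons, mem_slabLift_iff] at h
    exact hDA _ hE₁D h
  have hrest : rest ≠ [] := by
    rintro rfl
    -- then `E₁` is the last vertex of `γ`, and the only vertex over `D`: so `x = E₁` is the last
    have hlast : (Q.γ k ω).getLast hγO.ne_nil = E₁ := by
      rw [List.getLast_congr _ (by simp) hγ1]; simp
    have hxE : x = E₁ := by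
      rw [hγ1] at hxγ
      rcases List.mem_append.1 hxγ with h | h
      · exact absurd hxD (hp₀D x h)
      · simpa using h
    exact hxl (hxE.trans hlast.symm)
  exact ⟨p₀, E₁, rest, hγ1, hp₀, hrest, hp₀D, hE₁D⟩

/-- **A route to a target vertex plus port data is a surgery ending in `B̄`.** Given `ω ∈ evX`,
a cleared planar set `D ⊆ R` off `A`, a vertex of `Γ` other than its last over `D`, an end vertex
`β` over `D ∩ S ∩ B` off `Γ`'s first vertex over `D`, a port vertex `q₁ ∉ D̄` adjacent to `w'`
and `ω`-joined to `C̄` inside `(R ∖ D)‾`, and — for every candidate first vertex `E₁` of `Γ` over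
`D` — a route from `E₁` to `β` with branch to `w'` whose trunk interior lies over `S ∖ B`, there
is a `SurgeryB` with cleared set `D`. [cite: NewmanTassionWu2017, §3.2 (proof of Theorem 3.7, steps (1)–(3))] -/
theorem exists_surgeryB_of_route (hX : ω ∈ Q.evX k) {D : Set (ℤ × ℤ)} (hDR : D ⊆ Q.R)
    (hDA : ∀ z ∈ D, z ∉ Q.A)
    (hin : ∃ x ∈ Q.γ k ω, planar k x ∈ D ∧ x ≠ (Q.γ k ω).getLast (Q.γ_spec hX.1).1.ne_nil)
    {β w' q₁ cC : slab 3 k} (hβD : planar k β ∈ D) (hβS : planar k β ∈ Q.S) (hβB : planar k β ∈ Q.B)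
    (hadj : (slabGraph 3 k).Adj w' q₁) (hq₁D : planar k q₁ ∉ D)
    (hcC : cC ∈ slabLift k Q.C) (hσ : ω ∈ openConnIn (slabLift k (Q.R \ D)) q₁ cC)
    (hroute : ∀ E₁ : slab 3 k, E₁ ∈ Q.γ k ω → planar k E₁ ∈ D → E₁ ∉ slabLift k Q.B →
      ∃ L Br c, RouteSpec k D D E₁ β w' L Br c ∧
        ∀ v ∈ L, v ≠ E₁ → v ≠ β → planar k v ∈ Q.S ∧ planar k v ∉ Q.B) :
    ∃ sb : Q.SurgeryB k ω, sb.D = D := by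
  have hA : ω ∈ Q.evAB k := Q.evAB_of_evX hX
  obtain ⟨hγO, -⟩ := Q.γ_spec hA
  obtain ⟨p₀, E₁, rest, hγeq, hp₀, hrest, hp₀D, hE₁D⟩ := exists_decompB hA hDA hin
  have hE₁γ : E₁ ∈ Q.γ k ω := by rw [hγeq]; simp
  -- `E₁` is not the last vertex of `γ`, hence not over `B`
  have hE₁B : E₁ ∉ slabLift k Q.B := by
    intro hB
    have hex : ∃ l, IsOSAP k ω (slabLift k Q.S) (slabLift k Q.A) (slabLift k Q.B) l :=
      (mem_slabConn_iff_exists_isOSAP ω _ _ _).1 hA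
    have h := minPath_prefix_getLast_not_mem Q.S_finite hex (p := p₀ ++ [E₁]) (s := rest)
      (by rw [show minPath k ω _ _ _ = Q.γ k ω from rfl, hγeq]; simp) hrest (by simp)
    simp at h
    exact h hB
  have hE₁β : E₁ ≠ β := fun h => hE₁B (h ▸ hβB)
  obtain ⟨L, Br, c, spec, hint⟩ := hroute E₁ hE₁γ hE₁D hE₁B
  set P := L.tail.dropLast with hP
  have hLeq : L = E₁ :: (P ++ [β]) := spec.hL.eq_cons_dropLast_concat hE₁β
  have hPL : ∀ v ∈ P, v ∈ L := fun v hv => by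
    rw [hLeq]; exact List.mem_cons_of_mem _ (List.mem_append_left _ hv)
  have hPne : ∀ v ∈ P, v ≠ E₁ ∧ v ≠ β := by
    intro v hv
    have hnd := spec.hL.nodup
    rw [hLeq] at hnd
    refine ⟨fun h => ?_, fun h => ?_⟩
    · exact (List.nodup_cons.1 hnd).1 (List.mem_append_left _ (h ▸ hv))
    · have := (List.nodup_cons.1 hnd).2
      rw [List.nodup_append] at this
      exact this.2.2 v hv β (by simp) h
  have hq₁CB : q₁ ∉ c :: Br := by
    intro h
    rcases List.mem_cons.1 h with rfl | h
    · exact hq₁D (spec.hL_sub _ spec.hc)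
    · exact hq₁D (spec.hBr_sub _ h)
  have hCBq : SPath ((c :: Br) ++ [q₁]) c q₁ := spec.hCB.concat hadj hq₁CB
  have hc : c ∈ E₁ :: P := by
    have := spec.hc
    rw [hLeq] at this
    rcases List.mem_cons.1 this with h | h
    · exact List.mem_cons.2 (Or.inl h)
    · rcases List.mem_append.1 h with h | h
      · exact List.mem_cons_of_mem _ h
      · rw [List.mem_singleton] at h
        exact absurd h spec.hcE₂
  refine ⟨⟨D, p₀, E₁, rest, P, β, c, Br, q₁, cC, hDR, hDA, hγeq, hp₀, hrest, hp₀D, hE₁D,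
    fun x hx => spec.hL_sub x (hPL x hx),
    fun x hx => (hint x (hPL x hx) (hPne x hx).1 (hPne x hx).2).1,
    fun x hx => (hint x (hPL x hx) (hPne x hx).1 (hPne x hx).2).2,
    hβD, hβS, hβB,
    hLeq ▸ spec.hL.chain, hLeq ▸ spec.hL.nodup, hc, spec.hBr_sub, hq₁D,
    by simpa using hCBq.chain, by simpa using hCBq.nodup,
    fun x hx => hLeq ▸ spec.hBr_L x hx, fun l₁ l₂ y h => ?_, hcC, hσ⟩, rfl⟩
  have hh : (Br ++ [q₁]).head (by simp) = Br.head spec.hBr := by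
    simp [List.head_append_of_ne_nil spec.hBr]
  rw [hh]
  exact spec.hfwd l₁ l₂ y (hLeq.trans h) _ (List.head?_eq_some_head spec.hBr ▸ rfl)

end NTW17

end Literature.Probability.Percolation
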